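import Literature.Probability.RandomPlanarGeometry.HexSAWPolygonCells
import HarnessLib

/-!
# Cell calculus for honeycomb polygon surgery, II: leaf removal (`−4`) and the ROOF move (`+2`) on cell sets

Topic `Literature/Probability/RandomPlanarGeometry` (lane «pcv-sawmu», a-p4 g21; sequel of `HexSAWPolygonCells.lean` — cells `(x, y)`,
`nbrs`, `perim`, `perim_insert` (the insertion law `Δ = 6 − 2·#contacts`), `IsLexmax`, the class-X flip `perim_insert_ul_of_isLexmax`).

This file adds the two remaining elementary moves of the recursive step-two injection «OMEGA» (`HOME/pub-sawmu-a-p4/g21/omega/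
THEOREM-OMEGA-g21.md` §2) read on hexagons:

* `perim_erase` — the removal law (`perim (S.erase c) + 6 = perim S + 2·#(nbrs c ∩ S.erase c)`), and `perim_erase_of_contacts_eq_one`:
  deleting a LEAF (a hexagon with exactly one contact) lowers the perimeter by `4` — the «remove the top spike» step of the recursion;
* `roof t j` — the hexagons `a_i = (t.x + 2i + 2, t.y)`, `i < j`, right of the top hexagon `t` on its row — and
  **`perim_union_roof_of_isLexmax`**: if `t` is the top hexagon, `L t ∉ S`, and the row below carries the run `e_i = (t.x + 2i + 1, t.y − 1) ∈ S`
  for `i < k` with `e_k ∉ S` (`k ≥ 1`), then `perim (S ∪ roof t k) = perim S + 2`: the roof cells `a_0, …, a_{k−2}` each have the three contacts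
  `a_{i−1}` (or `t`), `e_i`, `e_{i+1}` (`Δ = 0`) and the last one `a_{k−1}` has two (`Δ = +2`).  This is the tree's Y⋆ roof surgery
  `HexSAWPolygonStepTwoYStar.spliceYs` (walk form) read on hexagons; with `perim_insert_ul_of_isLexmax` it covers the map `E` of the
  step-two line on every polygon whose top hexagon is not an up-right spike.

Sources: N. Madras, G. Slade, *The Self-Avoiding Walk* (1993), §3.2, proof of Theorem 3.2.3 [MadrasSlade1993]; I. Jensen, J. Phys.: Conf.
Ser. 42 (2006) 163 (honeycomb polygons by perimeter) [Jensen2006HoneycombPolygons].  Label (lane): LANE INFRASTRUCTURE; nothing new in writing.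
-/

open Finset

namespace Literature.Probability.RandomPlanarGeometry.SAW

namespace HexCell

/-! ### Removal -/

/-- **The removal law**: for `c ∈ S`, `perim (S.erase c) + 6 = perim S + 2·#(nbrs c ∩ S.erase c)` (the insertion law read backwards).
[cite: MadrasSlade1993, §3.2 (proof of Theorem 3.2.3: the effect of the surgery on the length)] -/
theorem perim_erase {S : Finset Cell} {c : Cell} (hc : c ∈ S) :
    perim (S.erase c) + 6 = perim S + 2 * #(nbrs c ∩ S.erase c) := by
  have h := perim_insert (S := S.erase c) (c := c) (notMem_erase c S)
  rw [insert_erase hc] at h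
  omega

/-- Deleting a LEAF (a hexagon of `S` with exactly one contact) lowers the perimeter by `4`.
[cite: MadrasSlade1993, §3.2 (proof of Theorem 3.2.3)] -/
theorem perim_erase_of_contacts_eq_one {S : Finset Cell} {c : Cell} (hc : c ∈ S) (h : #(nbrs c ∩ S.erase c) = 1) :
    perim (S.erase c) + 4 = perim S := by
  have := perim_erase hc; rw [h] at this; omega

/-! ### The roof -/

/-- The `i`-th roof hexagon right of `t` on its row: `a_i = (t.x + 2i + 2, t.y)` (`a_0 = R t`).
[cite: MadrasSlade1993, §3.2 (proof of Theorem 3.2.3: the cells added by the surgery)] -/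
def roofCell (t : Cell) (i : ℕ) : Cell := (t.1 + 2 * (i : ℤ) + 2, t.2)

/-- The `i`-th hexagon of the run below the roof: `e_i = (t.x + 2i + 1, t.y − 1)` (`e_0 = LR t`).
[cite: MadrasSlade1993, §3.2 (proof of Theorem 3.2.3)] -/
def runCell (t : Cell) (i : ℕ) : Cell := (t.1 + 2 * (i : ℤ) + 1, t.2 - 1)

/-- The abscissa of `roofCell t i`. [cite: MadrasSlade1993, §3.2 (proof of Theorem 3.2.3)] -/
@[simp] theorem roofCell_fst (t : Cell) (i : ℕ) : (roofCell t i).1 = t.1 + 2 * (i : ℤ) + 2 := rfl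
/-- The row of `roofCell t i`. [cite: MadrasSlade1993, §3.2 (proof of Theorem 3.2.3)] -/
@[simp] theorem roofCell_snd (t : Cell) (i : ℕ) : (roofCell t i).2 = t.2 := rfl
/-- The abscissa of `runCell t i`. [cite: MadrasSlade1993, §3.2 (proof of Theorem 3.2.3)] -/
@[simp] theorem runCell_fst (t : Cell) (i : ℕ) : (runCell t i).1 = t.1 + 2 * (i : ℤ) + 1 := rfl
/-- The row of `runCell t i`. [cite: MadrasSlade1993, §3.2 (proof of Theorem 3.2.3)] -/
@[simp] theorem runCell_snd (t : Cell) (i : ℕ) : (runCell t i).2 = t.2 - 1 := rfl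

/-- The roof of length `j` right of `t`: `{a_0, …, a_{j−1}}`. [cite: MadrasSlade1993, §3.2 (proof of Theorem 3.2.3)] -/
def roof (t : Cell) (j : ℕ) : Finset Cell := (range j).image (roofCell t)

/-- `roofCell t` is injective. [cite: MadrasSlade1993, §3.2 (proof of Theorem 3.2.3)] -/
theorem roofCell_injective (t : Cell) : Function.Injective (roofCell t) := by
  intro i j h
  have := congrArg Prod.fst h
  simp only [roofCell_fst] at this
  omega

/-- Membership in the roof. [cite: MadrasSlade1993, §3.2 (proof of Theorem 3.2.3)] -/
theorem mem_roof {t : Cell} {j : ℕ} {c : Cell} : c ∈ roof t j ↔ ∃ i < j, roofCell t i = c := by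
  simp [roof]

/-- The roof has `j` hexagons. [cite: MadrasSlade1993, §3.2 (proof of Theorem 3.2.3)] -/
theorem card_roof (t : Cell) (j : ℕ) : #(roof t j) = j := by
  rw [roof, card_image_of_injective _ (roofCell_injective t), card_range]

/-- `roof t (j+1) = insert a_j (roof t j)`. [cite: MadrasSlade1993, §3.2 (proof of Theorem 3.2.3)] -/
theorem roof_succ (t : Cell) (j : ℕ) : roof t (j + 1) = insert (roofCell t j) (roof t j) := by
  rw [roof, roof, range_add_one, image_insert]

/-- Roof hexagons lie on the top row, right of `t`, hence outside `S`. [cite: MadrasSlade1993, §3.2 (proof of Theorem 3.2.3)] -/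
theorem IsLexmax.roofCell_notMem {S : Finset Cell} {t : Cell} (h : IsLexmax S t) (i : ℕ) : roofCell t i ∉ S :=
  h.notMem_of_right (by simp) (by simp; omega)

/-- The roof is disjoint from `S`. [cite: MadrasSlade1993, §3.2 (proof of Theorem 3.2.3)] -/
theorem IsLexmax.disjoint_roof {S : Finset Cell} {t : Cell} (h : IsLexmax S t) (j : ℕ) : Disjoint S (roof t j) := by
  rw [disjoint_iff_ne]
  rintro a ha b hb rfl
  obtain ⟨i, -, rfl⟩ := mem_roof.1 hb
  exact h.roofCell_notMem i ha

/-- **The contacts of the next roof hexagon.**  With `t` the top hexagon, the run `e_0, …, e_{k−1} ⊆ S` and `e_k ∉ S`: for `j < k` the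
hexagon `a_j` has, in `S ∪ roof t j`, exactly the contacts `a_{j−1}` (resp. `t` if `j = 0`), `e_j`, and — iff `j + 1 < k` — `e_{j+1}`.
[cite: MadrasSlade1993, §3.2 (proof of Theorem 3.2.3)] -/
theorem card_contacts_roofCell {S : Finset Cell} {t : Cell} (h : IsLexmax S t) {k j : ℕ} (hjk : j < k)
    (hrun : ∀ i < k, runCell t i ∈ S) (hend : runCell t k ∉ S) :
    #(nbrs (roofCell t j) ∩ (S ∪ roof t j)) = if j + 1 < k then 3 else 2 := by
  classical
  obtain ⟨a, b⟩ := t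
  have ht := h.1
  -- names for the six neighbours of `a_j = (a + 2j + 2, b)`, written exactly as `mem_nbrs_iff` produces them
  have hleft : ((a + 2 * (j : ℤ) + 2 - 2, b) : Cell) ∈ S ∪ roof (a, b) j := by
    rcases Nat.eq_zero_or_pos j with rfl | hj
    · apply mem_union_left
      have e : ((a + 2 * ((0 : ℕ) : ℤ) + 2 - 2, b) : Cell) = (a, b) := by ext <;> simp
      rw [e]; exact ht
    · refine mem_union_right _ (mem_roof.2 ⟨j - 1, by omega, ?_⟩)
      ext <;> simp [roofCell]; omega
  have hll : ((a + 2 * (j : ℤ) + 2 - 1, b - 1) : Cell) ∈ S := by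
    have e : runCell (a, b) j = (a + 2 * (j : ℤ) + 2 - 1, b - 1) := by ext <;> simp; ring
    rw [← e]; exact hrun j hjk
  have hlr : ((a + 2 * (j : ℤ) + 2 + 1, b - 1) : Cell) ∈ S ↔ j + 1 < k := by
    constructor
    · intro hm
      by_contra hc
      apply hend
      have e : runCell (a, b) k = (a + 2 * (j : ℤ) + 2 + 1, b - 1) := by
        ext <;> simp
        have : k = j + 1 := by omega
        subst this; push_cast; ring
      rw [e]; exact hm
    · intro hj
      have e : runCell (a, b) (j + 1) = (a + 2 * (j : ℤ) + 2 + 1, b - 1) := by ext <;> simp; ring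
      rw [← e]; exact hrun (j + 1) hj
  have hlr' : ((a + 2 * (j : ℤ) + 2 + 1, b - 1) : Cell) ∉ roof (a, b) j := by
    intro hm
    obtain ⟨i, -, e⟩ := mem_roof.1 hm
    have := congrArg Prod.snd e; simp only [roofCell_snd] at this; omega
  have hR : ((a + 2 * (j : ℤ) + 2 + 2, b) : Cell) ∉ S ∪ roof (a, b) j := by
    rw [mem_union, not_or]
    refine ⟨h.notMem_of_right (by simp) (by simp; omega), fun hm => ?_⟩
    obtain ⟨i, hi, e⟩ := mem_roof.1 hm
    have := congrArg Prod.fst e; simp only [roofCell_fst] at this; omega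
  have hUR : ((a + 2 * (j : ℤ) + 2 + 1, b + 1) : Cell) ∉ S ∪ roof (a, b) j := by
    rw [mem_union, not_or]
    refine ⟨h.notMem_of_row_lt (by simp), fun hm => ?_⟩
    obtain ⟨i, -, e⟩ := mem_roof.1 hm
    have := congrArg Prod.snd e; simp only [roofCell_snd] at this; omega
  have hUL : ((a + 2 * (j : ℤ) + 2 - 1, b + 1) : Cell) ∉ S ∪ roof (a, b) j := by
    rw [mem_union, not_or]
    refine ⟨h.notMem_of_row_lt (by simp), fun hm => ?_⟩
    obtain ⟨i, -, e⟩ := mem_roof.1 hm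
    have := congrArg Prod.snd e; simp only [roofCell_snd] at this; omega
  by_cases hj : j + 1 < k
  · rw [if_pos hj]
    have e : nbrs (roofCell (a, b) j) ∩ (S ∪ roof (a, b) j) =
        {(a + 2 * (j : ℤ) + 2 - 1, b - 1), (a + 2 * (j : ℤ) + 2 + 1, b - 1), (a + 2 * (j : ℤ) + 2 - 2, b)} := by
      ext d
      simp only [mem_inter, mem_nbrs_iff, roofCell_fst, roofCell_snd, mem_insert, mem_singleton]
      constructor
      · rintro ⟨hd, hdS⟩
        rcases hd with rfl | rfl | rfl | rfl | rfl | rfl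
        · exact Or.inl rfl
        · exact Or.inr (Or.inl rfl)
        · exact absurd hdS hR
        · exact absurd hdS hUR
        · exact absurd hdS hUL
        · exact Or.inr (Or.inr rfl)
      · rintro (rfl | rfl | rfl)
        · exact ⟨Or.inl rfl, mem_union_left _ hll⟩
        · exact ⟨Or.inr (Or.inl rfl), mem_union_left _ (hlr.2 hj)⟩
        · exact ⟨Or.inr (Or.inr (Or.inr (Or.inr (Or.inr rfl)))), hleft⟩
    rw [e, card_insert_of_notMem, card_insert_of_notMem, card_singleton]
    · simp only [mem_singleton, Prod.mk.injEq]; omega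
    · simp only [mem_insert, mem_singleton, Prod.mk.injEq]; omega
  · rw [if_neg hj]
    have e : nbrs (roofCell (a, b) j) ∩ (S ∪ roof (a, b) j) = {(a + 2 * (j : ℤ) + 2 - 1, b - 1), (a + 2 * (j : ℤ) + 2 - 2, b)} := by
      ext d
      simp only [mem_inter, mem_nbrs_iff, roofCell_fst, roofCell_snd, mem_insert, mem_singleton]
      constructor
      · rintro ⟨hd, hdS⟩
        rcases hd with rfl | rfl | rfl | rfl | rfl | rfl
        · exact Or.inl rfl
        · exfalso
          rcases mem_union.1 hdS with hx | hx
          · exact hj (hlr.1 hx)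
          · exact hlr' hx
        · exact absurd hdS hR
        · exact absurd hdS hUR
        · exact absurd hdS hUL
        · exact Or.inr rfl
      · rintro (rfl | rfl)
        · exact ⟨Or.inl rfl, mem_union_left _ hll⟩
        · exact ⟨Or.inr (Or.inr (Or.inr (Or.inr (Or.inr rfl)))), hleft⟩
    rw [e, card_insert_of_notMem, card_singleton]
    simp only [mem_singleton, Prod.mk.injEq]; omega

/-- Partial roofs cost nothing: for `j ≤ k − 1`, `perim (S ∪ roof t j) = perim S`. [cite: MadrasSlade1993, §3.2 (proof of Theorem 3.2.3)] -/
theorem perim_union_roof_of_lt {S : Finset Cell} {t : Cell} (h : IsLexmax S t) {k : ℕ}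
    (hrun : ∀ i < k, runCell t i ∈ S) (hend : runCell t k ∉ S) {j : ℕ} (hj : j + 1 ≤ k) :
    perim (S ∪ roof t j) = perim S := by
  classical
  induction j with
  | zero => simp [roof]
  | succ j ih =>
    have hj' : j + 1 < k := by omega
    rw [roof_succ, union_insert]
    have hnot : roofCell t j ∉ S ∪ roof t j := by
      rw [mem_union, not_or]
      refine ⟨h.roofCell_notMem j, fun hm => ?_⟩
      obtain ⟨i, hi, e⟩ := mem_roof.1 hm
      have := roofCell_injective t e; omega
    have hins := perim_insert hnot
    rw [card_contacts_roofCell h (by omega) hrun hend, if_pos hj'] at hins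
    have := ih (by omega)
    omega

/-- **The roof move is a `+2` move**: with `t` the top hexagon, the run `e_0, …, e_{k−1} ⊆ S` below-right of it (`k ≥ 1`) and `e_k ∉ S`,
`perim (S ∪ roof t k) = perim S + 2`.  (`L t ∉ S` — the tree's class Y⋆ condition — is what makes this the chosen move; it is not needed for
the count.)  This is `HexSAWPolygonStepTwoYStar`'s roof surgery read on hexagons.
[cite: MadrasSlade1993, §3.2, Theorem 3.2.3 (3.2.3) and its proof (surgery at the largest point), transplanted to `ℍ`] -/
theorem perim_union_roof_of_isLexmax {S : Finset Cell} {t : Cell} (h : IsLexmax S t) {k : ℕ} (hk : 1 ≤ k)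
    (hrun : ∀ i < k, runCell t i ∈ S) (hend : runCell t k ∉ S) :
    perim (S ∪ roof t k) = perim S + 2 := by
  classical
  obtain ⟨j, rfl⟩ : ∃ j, k = j + 1 := ⟨k - 1, by omega⟩
  rw [roof_succ, union_insert]
  have hnot : roofCell t j ∉ S ∪ roof t j := by
    rw [mem_union, not_or]
    refine ⟨h.roofCell_notMem j, fun hm => ?_⟩
    obtain ⟨i, hi, e⟩ := mem_roof.1 hm
    have := roofCell_injective t e; omega
  have hins := perim_insert hnot
  rw [card_contacts_roofCell h (by omega) hrun hend, if_neg (by omega)] at hins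
  have := perim_union_roof_of_lt h hrun hend (le_refl (j + 1))
  omega

/-- The roofed set has `#S + k` hexagons. [cite: MadrasSlade1993, §3.2 (proof of Theorem 3.2.3)] -/
theorem card_union_roof_of_isLexmax {S : Finset Cell} {t : Cell} (h : IsLexmax S t) (k : ℕ) :
    #(S ∪ roof t k) = #S + k := by
  rw [card_union_of_disjoint (h.disjoint_roof k), card_roof]

end HexCell

end Literature.Probability.RandomPlanarGeometry.SAW
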